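import Mathlib.Algebra.Group.Subgroup.Basic
import Mathlib.Algebra.Group.Hom.Instances
import HarnessLib

/-!
# Route UniversalToricDescent — the engine of the `Σ → ∅` passage over `K_∞`: a `ψ`-stable subgroup
# `B ≤ P` with `ψ` ONTO `B`, `ker ψ ≤ B` and `ψ` locally nilpotent on `P` is all of `P`

Lead prover bsd-wall-utd-p1 g7 (`--supports stmt-BirchSwinnertonDyer-20399`; PRICING-20399-ALG-HALF §3(c)).
After `UniversalToricDescentSigmaCoinvariants` (the `Σ`-imprimitive coinvariants vanish) and
`UniversalToricDescentSigmaFreeTransport` (the λ-count against `B^Σ = Sel^Σ/Sel^∅`), the ONE algebraic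
input left in child 21845 is the identification of the local image
`B_v := im(Sel_𝔭^{Σ∪{v}}(K_∞, E[p^∞]) → P_v := ⊕_{w ∣ v} H¹(K_{∞,w}, E[p^∞]))` with ALL of `P_v`
(Greenberg–Vatsal Cor. (2.3): `loc_Σ` is onto over `K_∞`), after which `λ(X^Σ) − λ(X^∅)` is the sum of
the local coranks (GV Prop. (2.4), (2.10)) — the algebraic `Σ`-Euler factors. GV prove Cor. (2.3) from
a `Λ`-corank count (Prop. (2.1), Poitou–Tate over `ℚ_∞`). This file records a corank-FREE mechanism,
available because the `Σ`-coinvariants are now known to vanish: with `ψ = γ − 1` acting compatibly on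
`B_v ≤ P_v`,
  (a) `ψ` is onto `B_v` (a quotient of `Sel^{Σ∪{v}}(K_∞)`, on which `γ − 1` is onto —
      `UniversalToricDescentSigmaCoinvariants.surjective_conjSelmerAc_sub_one_of_noPTorsionPadic`);
  (b) `ker ψ|_{P_v} = P_v^Γ` = the classes inflated from `⊕_{w∣v} H¹(K_w, E[p^∞])` (procyclic descent for
      `D_v ↠ Γ_v`, `H²(Γ_v, ·) = 0`; tree `ProcyclicDescent.exists_resSubgroup_eq_of_forall_conjH1_eq`)
      and these lie in `B_v` by Poitou–Tate surjectivity AT THE BASE `K` (JSW17 Prop. 3.3.2, tree (P9)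
      `LocSurjAt`);
  (c) `ψ` is locally nilpotent on `P_v` (every local class comes from a finite layer);
so `B_v = P_v` by the elementary engine below (`eq_top_of_surjOn_of_ker_le_of_locallyNilpotent`: induct on
the nilpotency index — if `ψ^{N+1} x = 0` then `ψ x ∈ B` by induction, `ψ x = ψ b` with `b ∈ B` by (a),
`x − b ∈ ker ψ ≤ B` by (b)). Steps (a)–(c) in the tree's vocabulary (the signature map of
`UniversalToricDescentSigmaPassage`, Shapiro bookkeeping for the `p^{c_v}` places above `v`) are successor
work; nothing about Selmer groups is asserted here.

THEOREMS ONLY (pure group theory); no definition, no named fact, no `sorry`. BSD is not advanced by this file.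
References: [GreenbergVatsal2000] §2 Prop. (2.1), Cor. (2.3), Prop. (2.4), (2.10) (pp. 23–28);
[JetchevSkinnerWan2017] Prop. 3.3.2, Lemma 3.3.3 (arXiv:1512.06894 pp. 11–12); [GreenbergLNM1716] §1 p. 60.
-/

set_option autoImplicit false
-- `…BirchSwinnertonDyer.BirchSwinnertonDyer.Theorems…` is the problem's mandated namespace (D-0017).
set_option linter.dupNamespace false

namespace Summit.BirchSwinnertonDyer.BirchSwinnertonDyer.Theorems.UniversalToricDescentSigmaLocalImage

universe v

variable {P : Type v} [AddCommGroup P]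

/-- **Engine.** Let `ψ` be an endomorphism of an abelian group `P` and `B ≤ P` a subgroup such that
(a) every element of `B` is `ψ` of an element of `B`, (b) `ker ψ ≤ B`, (c) `ψ` is locally nilpotent on
`P`. Then `B = P`. (For `P = ⊕_{w∣v} H¹(K_{∞,w}, E[p^∞])`, `ψ = γ − 1`, `B` the image of the
`Σ`-imprimitive Selmer group this is `loc_v` onto over `K_∞`, GV Cor. (2.3), from (a) the vanishing of the
`Σ`-coinvariants, (b) base surjectivity, (c) discreteness.) [cite: GreenbergVatsal2000, §2 Cor. (2.3) (p. 25)] -/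
theorem eq_top_of_surjOn_of_ker_le_of_locallyNilpotent (ψ : AddMonoid.End P) (B : AddSubgroup P)
    (hsurj : ∀ b ∈ B, ∃ b' ∈ B, ψ b' = b) (hker : ∀ x : P, ψ x = 0 → x ∈ B)
    (hnil : ∀ x : P, ∃ N : ℕ, (ψ ^ N) x = 0) : B = ⊤ := by
  have key : ∀ (N : ℕ) (x : P), (ψ ^ N) x = 0 → x ∈ B := by
    intro N
    induction N with
    | zero =>
      intro x hN
      rw [pow_zero, AddMonoid.End.one_apply] at hN
      rw [hN]
      exact B.zero_mem
    | succ N ih =>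
      intro x hN
      have hx1 : ψ x ∈ B := by
        refine ih (ψ x) ?_
        have e : (ψ ^ (N + 1)) x = (ψ ^ N) (ψ x) := by
          rw [pow_succ, AddMonoid.End.coe_mul, Function.comp_apply]
        rw [← e]
        exact hN
      obtain ⟨b, hb, hbx⟩ := hsurj (ψ x) hx1
      have hxb : x - b ∈ B := hker (x - b) (by rw [map_sub, hbx, sub_self])
      have hx : x = (x - b) + b := (sub_add_cancel x b).symm
      rw [hx]
      exact B.add_mem hxb hb
  rw [eq_top_iff]
  intro x _
  obtain ⟨N, hN⟩ := hnil x
  exact key N x hN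

/-- **Engine, image form.** For additive maps `Φ : A → P` (the localisation at the places above `v`),
`φ : A → A` (the action of `γ − 1` on the global group) and `ψ : P → P` (its action on the local group)
with `Φ ∘ φ = ψ ∘ Φ`: if `φ` is onto `A`, `ker ψ ⊆ im Φ` and `ψ` is locally nilpotent, then `Φ` is ONTO.
[cite: GreenbergVatsal2000, §2 Cor. (2.3) (p. 25)] -/
theorem surjective_of_comm_of_surjective_of_ker_le {A : Type*} [AddCommGroup A] (Φ : A →+ P)
    (φ : AddMonoid.End A) (ψ : AddMonoid.End P) (hcomm : ∀ a : A, Φ (φ a) = ψ (Φ a))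
    (hφ : Function.Surjective φ) (hker : ∀ x : P, ψ x = 0 → x ∈ Φ.range)
    (hnil : ∀ x : P, ∃ N : ℕ, (ψ ^ N) x = 0) : Function.Surjective Φ := by
  have htop : Φ.range = ⊤ := by
    refine eq_top_of_surjOn_of_ker_le_of_locallyNilpotent ψ Φ.range ?_ hker hnil
    rintro _ ⟨a, rfl⟩
    obtain ⟨a', rfl⟩ := hφ a
    exact ⟨Φ a', ⟨a', rfl⟩, (hcomm a').symm⟩
  exact AddMonoidHom.range_eq_top.mp htop

end Summit.BirchSwinnertonDyer.BirchSwinnertonDyer.Theorems.UniversalToricDescentSigmaLocalImage
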